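import Summits.CriticalPhenomena.PercolationContinuityZ3.Theorems.Transplant.FKConnectivityAllQAntipodalAnd4Parallel
import HarnessLib

/-!
# Connectivity correlation inequalities for `φ_{w,q}`, every `q > 0` — file 32a: `C_∞(and)` AT EVERY LEVEL — the GENERAL PARALLEL JUNCTION
# IDENTITY (arbitrary attached edge sets on both sides; the parallel identity of file 28 and the R-extension identity of file 29 are its
# specialisations `A₁ = {ab}, A₂ = {cd}, C = ∅` and `A₂ = C₂ = ∅`)

Support file (`--supports stmt-CriticalPhenomena-4575`), FK sub-lane `prim-bschramm-fk-2` (gen 19) of the post-continuity programme; builds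
on p205010 (kernel theorem, internal audit signed; external expert review pending).  No definitions, no named facts, no sorries; standard axioms.

The general AND-drift of file 32 (`∑_{γ ⊆ N} (q^{k(γ∪A∪st)+k((N\γ)∪C)} - q^{k((N\γ)∪A∪st)+k(γ∪C)}) h(γ)`: free set `N`, `S`-side attached set `A`,
contracted set `C`, root `st`) across a PARALLEL root of the host minus `st`: `E₁ ∥ E₂` between `s, t`, `N, A, C` split along the parts.  With
`ωᵢ = γᵢ ∪ Aᵢ`, `φᵢ = γᵢ ∪ Cᵢ`, `Yᵢ = k(ωᵢ ∪ st)`, `Φᵢ = k(φᵢ)`, `Bᵢ = k(φᵢ ∪ st)`, `vᵢ = 1{s ↮ t in φᵢ}` (bars for the complements):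
(`andGen_summand_parallel`)
`q^{2|V|} 𝔞(γ) = v̄₂ q^{Y₂+Φ̄₂+1}(q^{Y₁+Φ̄₁} - q^{Ȳ₁+Φ₁}) + v₁ q^{Ȳ₁+Φ₁+1}(q^{Y₂+Φ̄₂} - q^{Ȳ₂+Φ₂}) + (1-v̄₂) q^{Y₂+Φ̄₂+2}(q^{Y₁+B̄₁} - q^{B₁+Ȳ₁})
  + (1-v₁) q^{Ȳ₁+Φ₁+2}(q^{Y₂+B̄₂} - q^{B₂+Ȳ₂})`
— the side functionals are the general AND-drift of side `i` with the SAME root `st` (attached `Aᵢ`, contracted `Cᵢ`) and the general AND-drift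
of side `i` with `st` CONTRACTED (attached `Aᵢ ∪ st`, contracted `Cᵢ ∪ st`, no root); sixteen cases in the indicators (the identity holds
with free exponents once `Bᵢ = Φᵢ - vᵢ` is substituted; verified on configurations with arbitrary `Aᵢ, Cᵢ`, explore/gen_verify.py).  Summing:
**`andGen_parallel_nonpos`**.  When `A₂ = C₂ = ∅` side 2 contributes only Theorem U (its contracted drift vanishes identically) — the R-extension
theorem of file 29; this is why the induction of file 32c needs no separate "theta" case.
[cite: Grimmett2006, §1.4 eq. (1.20) (p. 15); §3.8 Thm. (3.90) (pp. 61–62); §3.9 (pp. 63–64)] [cite: Wagner2006, Thm. 5.8(d), §5.3]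
-/

noncomputable section

namespace Summit.CriticalPhenomena.PercolationContinuityZ3.Theorems

namespace FK

open SimpleGraph Literature.Probability.LatticeModels Literature.Probability.Percolation
open scoped Classical

variable {V : Type*} [Fintype V]

section GenParallel

variable {E₁ E₂ : Finset (Sym2 V)} {V₁ V₂ : Set V} {s t : V}

/-- **General parallel junction, the `S`-side splits without cross term**: for `X ⊆ E₁`, `Y ⊆ E₂` (parts meeting only inside `{s, t}`):
`k(X ∪ Y ∪ st) + |V| = k(X ∪ st) + k(Y ∪ st) + 1`. [cite: Grimmett2006, §3.8 (pp. 61–62)] -/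
theorem clusterCount_junction_genParallel (h₁ : ∀ e ∈ (↑E₁ : Set (Sym2 V)), ∀ z ∈ e, z ∈ V₁)
    (h₂ : ∀ e ∈ (↑E₂ : Set (Sym2 V)), ∀ z ∈ e, z ∈ V₂) (hS : V₁ ∩ V₂ ⊆ {s, t}) (hst : s ≠ t)
    {X Y : Finset (Sym2 V)} (hX : X ⊆ E₁) (hY : Y ⊆ E₂) :
    clusterCount (↑(insert s(s, t) (X ∪ Y)) : BondConfig V) ∅ + Fintype.card V =
      clusterCount (↑(insert s(s, t) X) : BondConfig V) ∅ + clusterCount (↑(insert s(s, t) Y) : BondConfig V) ∅ + 1 := by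
  have kpar := clusterCount_union_parallel h₁ h₂ hS hst hX hY
  have kins := clusterCount_insert_add_ite (X ∪ Y) s t
  have hreach := reachable_union_parallel h₁ h₂ hS hX hY (s := s) (t := t)
  have y₁ := clusterCount_insert_add_ite X s t
  have y₂ := clusterCount_insert_add_ite Y s t
  have kins' : clusterCount (↑(insert s(s, t) (X ∪ Y)) : BondConfig V) ∅ +
      (if (openGraph (↑X : BondConfig V)).Reachable s t ∨ (openGraph (↑Y : BondConfig V)).Reachable s t then 0 else 1) =
        clusterCount (↑(X ∪ Y) : BondConfig V) ∅ := by
    by_cases h : (openGraph (↑X : BondConfig V)).Reachable s t ∨ (openGraph (↑Y : BondConfig V)).Reachable s t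
    · rw [if_pos h]; rw [if_pos (hreach.2 h)] at kins; exact kins
    · rw [if_neg h]; rw [if_neg (fun h' => h (hreach.1 h'))] at kins; exact kins
  by_cases p₁ : (openGraph (↑X : BondConfig V)).Reachable s t <;>
  by_cases p₂ : (openGraph (↑Y : BondConfig V)).Reachable s t <;>
  simp only [p₁, p₂, and_self, and_true, and_false, or_self, or_true, or_false, if_true, if_false, add_zero] at kpar kins' y₁ y₂ ⊢ <;>
  omega

set_option linter.unusedSimpArgs false in
/-- **THE GENERAL PARALLEL JUNCTION IDENTITY (pointwise)** — see the module docstring; sixteen cases in the indicators `1{s ↔ t in ·}` of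
`φ₁, φ̄₁, φ₂, φ̄₂`. [cite: Grimmett2006, §3.8 (pp. 61–62)] -/
theorem andGen_summand_parallel (q : ℝ) (h₁ : ∀ e ∈ (↑E₁ : Set (Sym2 V)), ∀ z ∈ e, z ∈ V₁)
    (h₂ : ∀ e ∈ (↑E₂ : Set (Sym2 V)), ∀ z ∈ e, z ∈ V₂) (hS : V₁ ∩ V₂ ⊆ {s, t}) (hst : s ≠ t)
    {N₁ A₁ C₁ N₂ A₂ C₂ γ₁ γ₂ : Finset (Sym2 V)} (hN₁ : N₁ ⊆ E₁) (hA₁ : A₁ ⊆ E₁) (hC₁ : C₁ ⊆ E₁)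
    (hN₂ : N₂ ⊆ E₂) (hA₂ : A₂ ⊆ E₂) (hC₂ : C₂ ⊆ E₂) (hγ₁ : γ₁ ⊆ N₁) (hγ₂ : γ₂ ⊆ N₂) (x : ℝ) :
    q ^ (2 * Fintype.card V) *
        ((q ^ (clusterCount (↑(insert s(s, t) ((γ₁ ∪ A₁) ∪ (γ₂ ∪ A₂))) : BondConfig V) ∅ +
              clusterCount (↑((N₁ \ γ₁ ∪ C₁) ∪ (N₂ \ γ₂ ∪ C₂)) : BondConfig V) ∅) -
          q ^ (clusterCount (↑(insert s(s, t) ((N₁ \ γ₁ ∪ A₁) ∪ (N₂ \ γ₂ ∪ A₂))) : BondConfig V) ∅ +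
              clusterCount (↑((γ₁ ∪ C₁) ∪ (γ₂ ∪ C₂)) : BondConfig V) ∅)) * x) =
      (if (openGraph (↑(N₂ \ γ₂ ∪ C₂) : BondConfig V)).Reachable s t then 0 else 1) *
          q ^ (clusterCount (↑(insert s(s, t) (γ₂ ∪ A₂)) : BondConfig V) ∅ + clusterCount (↑(N₂ \ γ₂ ∪ C₂) : BondConfig V) ∅ + 1) *
          ((q ^ (clusterCount (↑(insert s(s, t) (γ₁ ∪ A₁)) : BondConfig V) ∅ + clusterCount (↑(N₁ \ γ₁ ∪ C₁) : BondConfig V) ∅) -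
            q ^ (clusterCount (↑(insert s(s, t) (N₁ \ γ₁ ∪ A₁)) : BondConfig V) ∅ + clusterCount (↑(γ₁ ∪ C₁) : BondConfig V) ∅)) * x) +
      (if (openGraph (↑(γ₁ ∪ C₁) : BondConfig V)).Reachable s t then 0 else 1) *
          q ^ (clusterCount (↑(insert s(s, t) (N₁ \ γ₁ ∪ A₁)) : BondConfig V) ∅ + clusterCount (↑(γ₁ ∪ C₁) : BondConfig V) ∅ + 1) *
          ((q ^ (clusterCount (↑(insert s(s, t) (γ₂ ∪ A₂)) : BondConfig V) ∅ + clusterCount (↑(N₂ \ γ₂ ∪ C₂) : BondConfig V) ∅) -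
            q ^ (clusterCount (↑(insert s(s, t) (N₂ \ γ₂ ∪ A₂)) : BondConfig V) ∅ + clusterCount (↑(γ₂ ∪ C₂) : BondConfig V) ∅)) * x) +
      (if (openGraph (↑(N₂ \ γ₂ ∪ C₂) : BondConfig V)).Reachable s t then 1 else 0) *
          q ^ (clusterCount (↑(insert s(s, t) (γ₂ ∪ A₂)) : BondConfig V) ∅ + clusterCount (↑(N₂ \ γ₂ ∪ C₂) : BondConfig V) ∅ + 1) *
          (q * ((q ^ (clusterCount (↑(insert s(s, t) (γ₁ ∪ A₁)) : BondConfig V) ∅ + clusterCount (↑(insert s(s, t) (N₁ \ γ₁ ∪ C₁)) : BondConfig V) ∅) -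
            q ^ (clusterCount (↑(insert s(s, t) (N₁ \ γ₁ ∪ A₁)) : BondConfig V) ∅ + clusterCount (↑(insert s(s, t) (γ₁ ∪ C₁)) : BondConfig V) ∅)) * x)) +
      (if (openGraph (↑(γ₁ ∪ C₁) : BondConfig V)).Reachable s t then 1 else 0) *
          q ^ (clusterCount (↑(insert s(s, t) (N₁ \ γ₁ ∪ A₁)) : BondConfig V) ∅ + clusterCount (↑(γ₁ ∪ C₁) : BondConfig V) ∅ + 1) *
          (q * ((q ^ (clusterCount (↑(insert s(s, t) (γ₂ ∪ A₂)) : BondConfig V) ∅ + clusterCount (↑(insert s(s, t) (N₂ \ γ₂ ∪ C₂)) : BondConfig V) ∅) -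
            q ^ (clusterCount (↑(insert s(s, t) (N₂ \ γ₂ ∪ A₂)) : BondConfig V) ∅ + clusterCount (↑(insert s(s, t) (γ₂ ∪ C₂)) : BondConfig V) ∅)) * x)) := by
  have hω₁ : γ₁ ∪ A₁ ⊆ E₁ := Finset.union_subset (hγ₁.trans hN₁) hA₁
  have hωb₁ : N₁ \ γ₁ ∪ A₁ ⊆ E₁ := Finset.union_subset (Finset.sdiff_subset.trans hN₁) hA₁
  have hω₂ : γ₂ ∪ A₂ ⊆ E₂ := Finset.union_subset (hγ₂.trans hN₂) hA₂
  have hωb₂ : N₂ \ γ₂ ∪ A₂ ⊆ E₂ := Finset.union_subset (Finset.sdiff_subset.trans hN₂) hA₂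
  have hφ₁ : γ₁ ∪ C₁ ⊆ E₁ := Finset.union_subset (hγ₁.trans hN₁) hC₁
  have hφb₁ : N₁ \ γ₁ ∪ C₁ ⊆ E₁ := Finset.union_subset (Finset.sdiff_subset.trans hN₁) hC₁
  have hφ₂ : γ₂ ∪ C₂ ⊆ E₂ := Finset.union_subset (hγ₂.trans hN₂) hC₂
  have hφb₂ : N₂ \ γ₂ ∪ C₂ ⊆ E₂ := Finset.union_subset (Finset.sdiff_subset.trans hN₂) hC₂
  -- junction bookkeeping
  have eS := clusterCount_junction_genParallel h₁ h₂ hS hst hω₁ hω₂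
  have eSb := clusterCount_junction_genParallel h₁ h₂ hS hst hωb₁ hωb₂
  have eC := clusterCount_union_parallel h₁ h₂ hS hst hφb₁ hφb₂
  have eG := clusterCount_union_parallel h₁ h₂ hS hst hφ₁ hφ₂
  -- the contracted atoms versus the free ones
  have b₁ := clusterCount_insert_add_ite (γ₁ ∪ C₁) s t
  have bb₁ := clusterCount_insert_add_ite (N₁ \ γ₁ ∪ C₁) s t
  have b₂ := clusterCount_insert_add_ite (γ₂ ∪ C₂) s t
  have bb₂ := clusterCount_insert_add_ite (N₂ \ γ₂ ∪ C₂) s t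
  -- abbreviate the atoms
  set KS := clusterCount (↑(insert s(s, t) ((γ₁ ∪ A₁) ∪ (γ₂ ∪ A₂))) : BondConfig V) ∅
  set KSb := clusterCount (↑(insert s(s, t) ((N₁ \ γ₁ ∪ A₁) ∪ (N₂ \ γ₂ ∪ A₂))) : BondConfig V) ∅
  set KC := clusterCount (↑((N₁ \ γ₁ ∪ C₁) ∪ (N₂ \ γ₂ ∪ C₂)) : BondConfig V) ∅
  set KG := clusterCount (↑((γ₁ ∪ C₁) ∪ (γ₂ ∪ C₂)) : BondConfig V) ∅
  set Y₁ := clusterCount (↑(insert s(s, t) (γ₁ ∪ A₁)) : BondConfig V) ∅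
  set Yb₁ := clusterCount (↑(insert s(s, t) (N₁ \ γ₁ ∪ A₁)) : BondConfig V) ∅
  set Y₂ := clusterCount (↑(insert s(s, t) (γ₂ ∪ A₂)) : BondConfig V) ∅
  set Yb₂ := clusterCount (↑(insert s(s, t) (N₂ \ γ₂ ∪ A₂)) : BondConfig V) ∅
  set G₁ := clusterCount (↑(γ₁ ∪ C₁) : BondConfig V) ∅
  set Gb₁ := clusterCount (↑(N₁ \ γ₁ ∪ C₁) : BondConfig V) ∅
  set G₂ := clusterCount (↑(γ₂ ∪ C₂) : BondConfig V) ∅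
  set Gb₂ := clusterCount (↑(N₂ \ γ₂ ∪ C₂) : BondConfig V) ∅
  set B₁ := clusterCount (↑(insert s(s, t) (γ₁ ∪ C₁)) : BondConfig V) ∅
  set Bb₁ := clusterCount (↑(insert s(s, t) (N₁ \ γ₁ ∪ C₁)) : BondConfig V) ∅
  set B₂ := clusterCount (↑(insert s(s, t) (γ₂ ∪ C₂)) : BondConfig V) ∅
  set Bb₂ := clusterCount (↑(insert s(s, t) (N₂ \ γ₂ ∪ C₂)) : BondConfig V) ∅
  -- the left-hand side as one power
  have lhs1 : q ^ (2 * Fintype.card V) * q ^ (KS + KC) = q ^ (KS + Fintype.card V + (KC + Fintype.card V)) := by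
    rw [← pow_add]; congr 1; omega
  have lhs2 : q ^ (2 * Fintype.card V) * q ^ (KSb + KG) = q ^ (KSb + Fintype.card V + (KG + Fintype.card V)) := by
    rw [← pow_add]; congr 1; omega
  have expand : q ^ (2 * Fintype.card V) * ((q ^ (KS + KC) - q ^ (KSb + KG)) * x) =
      (q ^ (KS + Fintype.card V + (KC + Fintype.card V)) - q ^ (KSb + Fintype.card V + (KG + Fintype.card V))) * x := by
    rw [← lhs1, ← lhs2]; ring
  rw [expand, eS, eSb, eC, eG]
  by_cases r₁ : (openGraph (↑(γ₁ ∪ C₁) : BondConfig V)).Reachable s t <;>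
  by_cases rb₁ : (openGraph (↑(N₁ \ γ₁ ∪ C₁) : BondConfig V)).Reachable s t <;>
  by_cases r₂ : (openGraph (↑(γ₂ ∪ C₂) : BondConfig V)).Reachable s t <;>
  by_cases rb₂ : (openGraph (↑(N₂ \ γ₂ ∪ C₂) : BondConfig V)).Reachable s t <;>
  simp only [r₁, rb₁, r₂, rb₂, and_self, and_true, true_and, and_false, false_and, if_true, if_false,
    not_false_eq_true, not_true_eq_false, add_zero] at b₁ bb₁ b₂ bb₂ ⊢ <;>
  (rw [← b₁, ← bb₁, ← b₂, ← bb₂]; ring)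

/-- **THE GENERAL PARALLEL JUNCTION IDENTITY (summed).** [cite: Grimmett2006, §3.8 Thm. (3.90) (pp. 61–62)] -/
theorem andGen_parallel_eq (q : ℝ) (h₁ : ∀ e ∈ (↑E₁ : Set (Sym2 V)), ∀ z ∈ e, z ∈ V₁)
    (h₂ : ∀ e ∈ (↑E₂ : Set (Sym2 V)), ∀ z ∈ e, z ∈ V₂) (hS : V₁ ∩ V₂ ⊆ {s, t}) (hst : s ≠ t)
    {N₁ A₁ C₁ N₂ A₂ C₂ : Finset (Sym2 V)} (hd : Disjoint N₁ N₂) (hN₁ : N₁ ⊆ E₁) (hA₁ : A₁ ⊆ E₁) (hC₁ : C₁ ⊆ E₁)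
    (hN₂ : N₂ ⊆ E₂) (hA₂ : A₂ ⊆ E₂) (hC₂ : C₂ ⊆ E₂) (g : Finset (Sym2 V) → ℝ) :
    q ^ (2 * Fintype.card V) *
        ∑ γ ∈ (N₁ ∪ N₂).powerset,
          (q ^ (clusterCount (↑(insert s(s, t) (γ ∪ (A₁ ∪ A₂))) : BondConfig V) ∅ +
                clusterCount (↑((N₁ ∪ N₂) \ γ ∪ (C₁ ∪ C₂)) : BondConfig V) ∅) -
            q ^ (clusterCount (↑(insert s(s, t) ((N₁ ∪ N₂) \ γ ∪ (A₁ ∪ A₂))) : BondConfig V) ∅ +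
                clusterCount (↑(γ ∪ (C₁ ∪ C₂)) : BondConfig V) ∅)) * g γ =
      ∑ γ₂ ∈ N₂.powerset,
          ((if (openGraph (↑(N₂ \ γ₂ ∪ C₂) : BondConfig V)).Reachable s t then 0 else 1) *
              q ^ (clusterCount (↑(insert s(s, t) (γ₂ ∪ A₂)) : BondConfig V) ∅ + clusterCount (↑(N₂ \ γ₂ ∪ C₂) : BondConfig V) ∅ + 1) *
              ∑ γ₁ ∈ N₁.powerset, (q ^ (clusterCount (↑(insert s(s, t) (γ₁ ∪ A₁)) : BondConfig V) ∅ + clusterCount (↑(N₁ \ γ₁ ∪ C₁) : BondConfig V) ∅) -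
                q ^ (clusterCount (↑(insert s(s, t) (N₁ \ γ₁ ∪ A₁)) : BondConfig V) ∅ + clusterCount (↑(γ₁ ∪ C₁) : BondConfig V) ∅)) * g (γ₁ ∪ γ₂) +
            (if (openGraph (↑(N₂ \ γ₂ ∪ C₂) : BondConfig V)).Reachable s t then 1 else 0) *
              q ^ (clusterCount (↑(insert s(s, t) (γ₂ ∪ A₂)) : BondConfig V) ∅ + clusterCount (↑(N₂ \ γ₂ ∪ C₂) : BondConfig V) ∅ + 1) *
              (q * ∑ γ₁ ∈ N₁.powerset, (q ^ (clusterCount (↑(insert s(s, t) (γ₁ ∪ A₁)) : BondConfig V) ∅ +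
                    clusterCount (↑(insert s(s, t) (N₁ \ γ₁ ∪ C₁)) : BondConfig V) ∅) -
                q ^ (clusterCount (↑(insert s(s, t) (N₁ \ γ₁ ∪ A₁)) : BondConfig V) ∅ +
                    clusterCount (↑(insert s(s, t) (γ₁ ∪ C₁)) : BondConfig V) ∅)) * g (γ₁ ∪ γ₂))) +
        ∑ γ₁ ∈ N₁.powerset,
          ((if (openGraph (↑(γ₁ ∪ C₁) : BondConfig V)).Reachable s t then 0 else 1) *
              q ^ (clusterCount (↑(insert s(s, t) (N₁ \ γ₁ ∪ A₁)) : BondConfig V) ∅ + clusterCount (↑(γ₁ ∪ C₁) : BondConfig V) ∅ + 1) *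
              ∑ γ₂ ∈ N₂.powerset, (q ^ (clusterCount (↑(insert s(s, t) (γ₂ ∪ A₂)) : BondConfig V) ∅ + clusterCount (↑(N₂ \ γ₂ ∪ C₂) : BondConfig V) ∅) -
                q ^ (clusterCount (↑(insert s(s, t) (N₂ \ γ₂ ∪ A₂)) : BondConfig V) ∅ + clusterCount (↑(γ₂ ∪ C₂) : BondConfig V) ∅)) * g (γ₁ ∪ γ₂) +
            (if (openGraph (↑(γ₁ ∪ C₁) : BondConfig V)).Reachable s t then 1 else 0) *
              q ^ (clusterCount (↑(insert s(s, t) (N₁ \ γ₁ ∪ A₁)) : BondConfig V) ∅ + clusterCount (↑(γ₁ ∪ C₁) : BondConfig V) ∅ + 1) *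
              (q * ∑ γ₂ ∈ N₂.powerset, (q ^ (clusterCount (↑(insert s(s, t) (γ₂ ∪ A₂)) : BondConfig V) ∅ +
                    clusterCount (↑(insert s(s, t) (N₂ \ γ₂ ∪ C₂)) : BondConfig V) ∅) -
                q ^ (clusterCount (↑(insert s(s, t) (N₂ \ γ₂ ∪ A₂)) : BondConfig V) ∅ +
                    clusterCount (↑(insert s(s, t) (γ₂ ∪ C₂)) : BondConfig V) ∅)) * g (γ₁ ∪ γ₂))) := by
  rw [Finset.mul_sum, sum_powerset_union_disj hd]
  simp_rw [Finset.mul_sum, ← Finset.sum_add_distrib]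
  rw [Finset.sum_comm (s := N₂.powerset) (t := N₁.powerset), ← Finset.sum_add_distrib]
  refine Finset.sum_congr rfl fun γ₁ hγ₁ => ?_
  rw [← Finset.sum_add_distrib]
  refine Finset.sum_congr rfl fun γ₂ hγ₂ => ?_
  rw [Finset.mem_powerset] at hγ₁ hγ₂
  rw [union_sdiff_union hd hγ₁ hγ₂, Finset.union_union_union_comm γ₁ γ₂ A₁ A₂, Finset.union_union_union_comm (N₁ \ γ₁) (N₂ \ γ₂) C₁ C₂,
    Finset.union_union_union_comm (N₁ \ γ₁) (N₂ \ γ₂) A₁ A₂, Finset.union_union_union_comm γ₁ γ₂ C₁ C₂,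
    andGen_summand_parallel q h₁ h₂ hS hst hN₁ hA₁ hC₁ hN₂ hA₂ hC₂ hγ₁ hγ₂ (g (γ₁ ∪ γ₂))]
  ring

/-- **The general AND-drift across a parallel junction (abstract form).**  If on each side the general AND-drift with root `st` (attached
`Aᵢ`, contracted `Cᵢ`) and the `st`-CONTRACTED general AND-drift (attached `Aᵢ ∪ st`, contracted `Cᵢ ∪ st`) are `≤ 0` on every monotone test
function, then the general AND-drift of the composite (attached `A₁ ∪ A₂`, contracted `C₁ ∪ C₂`, root `st`) is `≤ 0` on every monotone `g`
(`q > 0`). [cite: Grimmett2006, §3.8 Thm. (3.90) (pp. 61–62)] -/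
theorem andGen_parallel_nonpos {q : ℝ} (hq : 0 < q) (h₁ : ∀ e ∈ (↑E₁ : Set (Sym2 V)), ∀ z ∈ e, z ∈ V₁)
    (h₂ : ∀ e ∈ (↑E₂ : Set (Sym2 V)), ∀ z ∈ e, z ∈ V₂) (hS : V₁ ∩ V₂ ⊆ {s, t}) (hst : s ≠ t)
    {N₁ A₁ C₁ N₂ A₂ C₂ : Finset (Sym2 V)} (hd : Disjoint N₁ N₂) (hN₁ : N₁ ⊆ E₁) (hA₁ : A₁ ⊆ E₁) (hC₁ : C₁ ⊆ E₁)
    (hN₂ : N₂ ⊆ E₂) (hA₂ : A₂ ⊆ E₂) (hC₂ : C₂ ⊆ E₂)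
    (hY₁ : ∀ h' : Finset (Sym2 V) → ℝ, (∀ ⦃A B : Finset (Sym2 V)⦄, A ⊆ B → B ⊆ N₁ → h' A ≤ h' B) →
      ∑ γ₁ ∈ N₁.powerset, (q ^ (clusterCount (↑(insert s(s, t) (γ₁ ∪ A₁)) : BondConfig V) ∅ + clusterCount (↑(N₁ \ γ₁ ∪ C₁) : BondConfig V) ∅) -
        q ^ (clusterCount (↑(insert s(s, t) (N₁ \ γ₁ ∪ A₁)) : BondConfig V) ∅ + clusterCount (↑(γ₁ ∪ C₁) : BondConfig V) ∅)) * h' γ₁ ≤ 0)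
    (hX₁ : ∀ h' : Finset (Sym2 V) → ℝ, (∀ ⦃A B : Finset (Sym2 V)⦄, A ⊆ B → B ⊆ N₁ → h' A ≤ h' B) →
      ∑ γ₁ ∈ N₁.powerset, (q ^ (clusterCount (↑(insert s(s, t) (γ₁ ∪ A₁)) : BondConfig V) ∅ +
          clusterCount (↑(insert s(s, t) (N₁ \ γ₁ ∪ C₁)) : BondConfig V) ∅) -
        q ^ (clusterCount (↑(insert s(s, t) (N₁ \ γ₁ ∪ A₁)) : BondConfig V) ∅ +
          clusterCount (↑(insert s(s, t) (γ₁ ∪ C₁)) : BondConfig V) ∅)) * h' γ₁ ≤ 0)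
    (hY₂ : ∀ h' : Finset (Sym2 V) → ℝ, (∀ ⦃A B : Finset (Sym2 V)⦄, A ⊆ B → B ⊆ N₂ → h' A ≤ h' B) →
      ∑ γ₂ ∈ N₂.powerset, (q ^ (clusterCount (↑(insert s(s, t) (γ₂ ∪ A₂)) : BondConfig V) ∅ + clusterCount (↑(N₂ \ γ₂ ∪ C₂) : BondConfig V) ∅) -
        q ^ (clusterCount (↑(insert s(s, t) (N₂ \ γ₂ ∪ A₂)) : BondConfig V) ∅ + clusterCount (↑(γ₂ ∪ C₂) : BondConfig V) ∅)) * h' γ₂ ≤ 0)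
    (hX₂ : ∀ h' : Finset (Sym2 V) → ℝ, (∀ ⦃A B : Finset (Sym2 V)⦄, A ⊆ B → B ⊆ N₂ → h' A ≤ h' B) →
      ∑ γ₂ ∈ N₂.powerset, (q ^ (clusterCount (↑(insert s(s, t) (γ₂ ∪ A₂)) : BondConfig V) ∅ +
          clusterCount (↑(insert s(s, t) (N₂ \ γ₂ ∪ C₂)) : BondConfig V) ∅) -
        q ^ (clusterCount (↑(insert s(s, t) (N₂ \ γ₂ ∪ A₂)) : BondConfig V) ∅ +
          clusterCount (↑(insert s(s, t) (γ₂ ∪ C₂)) : BondConfig V) ∅)) * h' γ₂ ≤ 0)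
    {g : Finset (Sym2 V) → ℝ} (hmono : ∀ ⦃A B : Finset (Sym2 V)⦄, A ⊆ B → B ⊆ N₁ ∪ N₂ → g A ≤ g B) :
    ∑ γ ∈ (N₁ ∪ N₂).powerset,
        (q ^ (clusterCount (↑(insert s(s, t) (γ ∪ (A₁ ∪ A₂))) : BondConfig V) ∅ +
              clusterCount (↑((N₁ ∪ N₂) \ γ ∪ (C₁ ∪ C₂)) : BondConfig V) ∅) -
          q ^ (clusterCount (↑(insert s(s, t) ((N₁ ∪ N₂) \ γ ∪ (A₁ ∪ A₂))) : BondConfig V) ∅ +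
              clusterCount (↑(γ ∪ (C₁ ∪ C₂)) : BondConfig V) ∅)) * g γ ≤ 0 := by
  have hpos : 0 < q ^ (2 * Fintype.card V) := pow_pos hq _
  have key := andGen_parallel_eq q h₁ h₂ hS hst hd hN₁ hA₁ hC₁ hN₂ hA₂ hC₂ g
  suffices hle : q ^ (2 * Fintype.card V) *
      ∑ γ ∈ (N₁ ∪ N₂).powerset,
        (q ^ (clusterCount (↑(insert s(s, t) (γ ∪ (A₁ ∪ A₂))) : BondConfig V) ∅ +
              clusterCount (↑((N₁ ∪ N₂) \ γ ∪ (C₁ ∪ C₂)) : BondConfig V) ∅) -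
          q ^ (clusterCount (↑(insert s(s, t) ((N₁ ∪ N₂) \ γ ∪ (A₁ ∪ A₂))) : BondConfig V) ∅ +
              clusterCount (↑(γ ∪ (C₁ ∪ C₂)) : BondConfig V) ∅)) * g γ ≤ 0 by
    by_contra hcon
    exact absurd hle (not_le.2 (mul_pos hpos (not_le.1 hcon)))
  rw [key]
  have sec₁ : ∀ γ₂ ∈ N₂.powerset, ∀ ⦃A B : Finset (Sym2 V)⦄, A ⊆ B → B ⊆ N₁ → g (A ∪ γ₂) ≤ g (B ∪ γ₂) := by
    intro γ₂ hγ₂ A B hAB hB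
    rw [Finset.mem_powerset] at hγ₂
    exact hmono (Finset.union_subset_union hAB le_rfl) (Finset.union_subset_union hB hγ₂)
  have sec₂ : ∀ γ₁ ∈ N₁.powerset, ∀ ⦃A B : Finset (Sym2 V)⦄, A ⊆ B → B ⊆ N₂ → g (γ₁ ∪ A) ≤ g (γ₁ ∪ B) := by
    intro γ₁ hγ₁ A B hAB hB
    rw [Finset.mem_powerset] at hγ₁
    exact hmono (Finset.union_subset_union le_rfl hAB) (Finset.union_subset_union hγ₁ hB)
  refine add_nonpos (Finset.sum_nonpos fun γ₂ hγ₂ => ?_) (Finset.sum_nonpos fun γ₁ hγ₁ => ?_)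
  · have i₁ := hY₁ (fun γ₁ => g (γ₁ ∪ γ₂)) (sec₁ γ₂ hγ₂)
    have i₂ := hX₁ (fun γ₁ => g (γ₁ ∪ γ₂)) (sec₁ γ₂ hγ₂)
    refine add_nonpos (mul_nonpos_of_nonneg_of_nonpos (mul_nonneg ?_ (pow_nonneg hq.le _)) i₁)
      (mul_nonpos_of_nonneg_of_nonpos (mul_nonneg ?_ (pow_nonneg hq.le _)) (mul_nonpos_of_nonneg_of_nonpos hq.le i₂)) <;>
    split_ifs <;> norm_num
  · have i₁ := hY₂ (fun γ₂ => g (γ₁ ∪ γ₂)) (sec₂ γ₁ hγ₁)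
    have i₂ := hX₂ (fun γ₂ => g (γ₁ ∪ γ₂)) (sec₂ γ₁ hγ₁)
    refine add_nonpos (mul_nonpos_of_nonneg_of_nonpos (mul_nonneg ?_ (pow_nonneg hq.le _)) i₁)
      (mul_nonpos_of_nonneg_of_nonpos (mul_nonneg ?_ (pow_nonneg hq.le _)) (mul_nonpos_of_nonneg_of_nonpos hq.le i₂)) <;>
    split_ifs <;> norm_num

end GenParallel

end FK

end Summit.CriticalPhenomena.PercolationContinuityZ3.Theorems

end
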